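import Literature.Analysis.Complex.BacklundArgVariation
import HarnessLib

/-!
# Backlund's lemma, sharp form: Jensen's formula with the circle *average*, and no `+1`

Trunk T-ANALYSIS support (`Literature/Analysis/Complex`), companion of `BacklundArgVariation.lean`.
That file proves Backlund's lemma in Titchmarsh's textbook form
(`Literature.Analysis.Complex.abs_im_integral_logDeriv_le_backlund`):
`|Im ∫_a^b g'/g (x+iy) dx| ≤ π (log(M/|g(c+iy)|)/log(R/r) + 1)` with `M` a bound for `|g|` on the
*whole* disc `|z - (c+iy)| ≤ R`.  For explicit work (Backlund 1918, Rosser 1941, Trudgian 2014,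
Hasanalizade–Shen–Wong 2022 on `S(T)`) two classical refinements matter, and both are proved here:

* **Jensen with the mean.**  Jensen's formula bounds the number of zeros by the *circle average*
  of `log|G|`, not by `log max|G|`; when the majorant of `|g|` varies strongly around the circle
  (for `ζ` it ranges from `ζ(σ)` on the right to `t^{1/2-σ}…` on the left) the average is much
  smaller.  `Literature.Analysis.Complex.sum_divisor_le_of_circleAverage_le` (Mathlib's
  `AnalyticOnNhd.sum_divisor_le` with the hypothesis `circleAverage (log ‖f‖) c R ≤ A` in place of
  `‖f‖ ≤ M`), `Literature.Analysis.Complex.card_zeros_re_le_of_circleAverage_le`.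
* **The `N`-th power trick** (Backlund; cf. [HasanalizadeShenWong2022, §3, `f_N`]): applying the splitting argument to
  `(e g)^N` (`e = conj g(c+iy)/|g(c+iy)|`, so that `(e g)^N (c+iy) = |g(c+iy)|^N > 0`) the number of
  sign changes of `Re (e g)^N` is at most `N` times the Jensen bound while each piece still costs
  only `π`, now for `N · Δarg g`; dividing by `N` and letting `N → ∞` removes the `+1`:
  `Literature.Analysis.Complex.abs_im_integral_logDeriv_le_of_circleAverage_le`
  (`|Im ∫_a^b g'/g| ≤ π (A - log|g(c+iy)|)/log(R/r)` whenever a majorant `B ≥ 1` of `|g(z+iy)|`,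
  `|g(z̄+iy)|` on `|z-c| = R` has `circleAverage (log B) c R ≤ A`), and its sup-norm corollary
  `Literature.Analysis.Complex.abs_im_integral_logDeriv_le_backlund'` (the tree's lemma without `+1`).
* Two bookkeeping lemmas for evaluating such averages explicitly:
  `Literature.Analysis.Complex.circleAverage_re_eq` — for a majorant depending only on `Re z`,
  `circleAverage (b ∘ re) c R = π⁻¹ ∫₀^π b(c + R cos θ) dθ` (`c`, `R` real); and
  `Literature.Analysis.Complex.integral_le_sum_affine_cos` — if `F ≤ p_j + q_j cos` on consecutive
  arcs `[t_j, t_{j+1}]` then `∫_{t_0}^{t_m} F ≤ Σ_j (p_j (t_{j+1} - t_j) + q_j (sin t_{j+1} - sin t_j))`.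

Everything here is proved; there are no named facts and no definitions.

## References

* E. C. Titchmarsh, *The Theory of the Riemann Zeta-Function*, 2nd ed. (1986), §9.4.
* R. J. Backlund, *Über die Nullstellen der Riemannschen Zetafunktion*, Acta Math. 41 (1918),
  345–375, §§2–3.
* E. Hasanalizade, Q. Shen, P.-J. Wong, *Counting zeros of the Riemann zeta function*, J. Number
  Theory 235 (2022) 219–241, §3 (the functions `f_N` and Jensen’s formula). [HasanalizadeShenWong2022]
-/

noncomputable section

open Complex Set MeasureTheory Filter Topology intervalIntegral Metric MeromorphicOn
open scoped Real ComplexConjugate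

namespace Literature.Analysis.Complex

/-! ### Jensen's inequality with a circle-average hypothesis -/

/-- **Jensen's inequality, mean form.** If `f` is analytic on `|z - c| ≤ R`, `f c ≠ 0`,
`0 < r < R`, and the circle average of `log ‖f‖` over `|z - c| = R` is at most `A`, then the
number of zeros of `f` in `|z - c| ≤ r`, counted with multiplicity, is at most
`(A - log ‖f c‖) / log(R/r)` (Jensen's formula: the average equals
`log‖f c‖ + Σ_{|u-c| ≤ R} mult(u) log(R/|u-c|)`, and each zero in the small disc contributes at least
`log(R/r)`). [cite: Titchmarsh1986, §9.4] -/
theorem sum_divisor_le_of_circleAverage_le {c : ℂ} {r R A : ℝ} {f : ℂ → ℂ} (hr : 0 < r)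
    (hrR : r < R) (hf : AnalyticOnNhd ℂ f (closedBall c R)) (hfc : f c ≠ 0)
    (hA : Real.circleAverage (fun z ↦ Real.log ‖f z‖) c R ≤ A) :
    ((∑ᶠ u, MeromorphicOn.divisor f (closedBall c r) u : ℤ) : ℝ) ≤
      (A - Real.log ‖f c‖) / Real.log (R / r) := by
  have hR : 0 < R := hr.trans hrR
  have hf' : AnalyticOnNhd ℂ f (closedBall c |R|) := by rwa [abs_of_pos hR]
  have hlogRr : 0 < Real.log (R / r) := Real.log_pos (by rw [one_lt_div hr]; exact hrR)
  -- push the coercion inside the sum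
  have hcast : ((∑ᶠ u, MeromorphicOn.divisor f (closedBall c r) u : ℤ) : ℝ) =
      ∑ᶠ u, (MeromorphicOn.divisor f (closedBall c r) u : ℝ) :=
    map_finsum (Int.castRingHom ℝ)
      ((MeromorphicOn.divisor _ _).finiteSupport (isCompact_closedBall ..))
  rw [hcast, le_div_iff₀ hlogRr, finsum_mul]
  have jensen := hf'.circleAverage_log_norm hR.ne' hfc
  have hsubR : closedBall c r ⊆ closedBall c |R| := by
    rw [abs_of_pos hR]; exact closedBall_subset_closedBall hrR.le
  calc ∑ᶠ u, (MeromorphicOn.divisor f (closedBall c r) u : ℝ) * Real.log (R / r)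
      ≤ ∑ᶠ u, (MeromorphicOn.divisor f (closedBall c |R|) u : ℝ) *
          Real.log (R * ‖c - u‖⁻¹) := by
        refine finsum_le_finsum' ?_ ?_ fun u ↦ ?_
        · exact (MeromorphicOn.divisor f (closedBall c r)).finiteSupport
            (isCompact_closedBall ..) |>.subset fun _ _ ↦ (by simp_all)
        · exact (MeromorphicOn.divisor f (closedBall c |R|)).finiteSupport
            (isCompact_closedBall ..) |>.subset fun _ _ ↦ (by simp_all)
        · by_cases h1 : u ∈ closedBall c |R|
          · by_cases h2 : u ∈ closedBall c r
            · -- in the small disc the divisors agree and `log(R/r) ≤ log(R/|c-u|)`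
              have hdiv : MeromorphicOn.divisor f (closedBall c r) u =
                  MeromorphicOn.divisor f (closedBall c |R|) u := by
                rw [(hf'.mono hsubR).divisor_apply h2, hf'.divisor_apply h1]
              rw [hdiv]
              by_cases h3 : u = c
              · rw [h3, hf'.divisor_apply (by simp),
                  (hf' c (by simp)).analyticOrderAt_eq_zero.mpr hfc]
                simp
              · have hpos : 0 < ‖c - u‖ := norm_pos_iff.2 (sub_ne_zero.2 (Ne.symm h3))
                have hle : ‖c - u‖ ≤ r := by
                  rw [mem_closedBall, dist_eq_norm'] at h2; exact h2
                have h0 : (0 : ℤ) ≤ MeromorphicOn.divisor f (closedBall c |R|) u := by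
                  simpa using hf'.divisor_nonneg u
                gcongr
                rw [div_eq_mul_inv]
                exact mul_le_mul_of_nonneg_left (inv_anti₀ hpos hle) hR.le
            · -- in the annulus the left side vanishes and the right side is `≥ 0`
              simp only [h2, not_false_eq_true,
                Function.locallyFinsuppWithin.apply_eq_zero_of_notMem, Int.cast_zero, zero_mul]
              have h0 : (0 : ℤ) ≤ MeromorphicOn.divisor f (closedBall c |R|) u := by
                simpa using hf'.divisor_nonneg u
              refine mul_nonneg (by exact_mod_cast h0) (Real.log_nonneg ?_)
              rw [mem_closedBall, dist_eq_norm'] at h1 h2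
              push Not at h2
              have hpos : 0 < ‖c - u‖ := hr.trans h2
              rw [le_mul_inv_iff₀ hpos, one_mul]
              exact h1.trans (abs_of_pos hR).le
          · have h2 : u ∉ closedBall c r := fun h ↦ h1 (hsubR h)
            simp [h1, h2]
    _ = Real.circleAverage (fun z ↦ Real.log ‖f z‖) c R - Real.log ‖f c‖ := by
        rw [jensen]; ring
    _ ≤ A - Real.log ‖f c‖ := by linarith

/-- **Jensen's bound for the zeros of `Re g` on a segment, mean form.** Let `g` be analytic at
every point of the disc `|z - (c+iy)| ≤ R`, `Re g(c+iy) ≠ 0`, `0 < r < R`, and suppose the circle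
average of `log |G|` over `|z - c| = R` is at most `A`, where `G = backlundAux g y` is Backlund's
auxiliary function (`G(x) = Re g(x+iy)` for real `x`, `|G(z)| ≤ ½(|g(z+iy)| + |g(z̄+iy)|)`).  Then
any finite set `Z` of zeros of `x ↦ Re g(x+iy)` in `[c-r, c+r]` has
`#Z ≤ (A - log|Re g(c+iy)|)/log(R/r)`. [cite: Titchmarsh1986, §9.4] -/
theorem card_zeros_re_le_of_circleAverage_le {g : ℂ → ℂ} {c y r R A : ℝ} (hr : 0 < r)
    (hrR : r < R) (hg : ∀ z ∈ closedBall ((c : ℂ) + y * I) R, AnalyticAt ℂ g z)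
    (hc : (g (c + y * I)).re ≠ 0)
    (hA : Real.circleAverage (fun z ↦ Real.log ‖backlundAux g y z‖) c R ≤ A)
    (Z : Finset ℝ) (hZ : ∀ x ∈ Z, x ∈ Icc (c - r) (c + r) ∧ (g (x + y * I)).re = 0) :
    (Z.card : ℝ) ≤ (A - Real.log |(g (c + y * I)).re|) / Real.log (R / r) := by
  set G := backlundAux g y with hG
  have hR : 0 < R := hr.trans hrR
  have hGan : AnalyticOnNhd ℂ G (closedBall (c : ℂ) R) := by
    intro z hz
    obtain ⟨h1, h2⟩ := mem_closedBall_shift (y := y) hz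
    exact analyticAt_backlundAux (hg _ h1) (hg _ h2)
  have hGc : G c = ((g (c + y * I)).re : ℂ) := backlundAux_ofReal g y c
  have hGc0 : G c ≠ 0 := by rw [hGc, Complex.ofReal_ne_zero]; exact hc
  have hnormGc : ‖G c‖ = |(g (c + y * I)).re| := by rw [hGc, Complex.norm_real, Real.norm_eq_abs]
  have hJ := sum_divisor_le_of_circleAverage_le hr hrR hGan hGc0 hA
  rw [hnormGc] at hJ
  refine le_trans ?_ hJ
  -- each point of `Z` carries divisor `≥ 1` (as in `card_zeros_re_le_jensen`)
  set U := closedBall (c : ℂ) r with hU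
  have hGanU : AnalyticOnNhd ℂ G U := fun z hz ↦ hGan z (closedBall_subset_closedBall hrR.le hz)
  have hmer : MeromorphicOn G U := hGanU.meromorphicOn
  set D := MeromorphicOn.divisor G U with hD
  have hfin : (Function.support fun u ↦ (D u : ℝ)).Finite := by
    refine (D.finiteSupport (isCompact_closedBall _ _)).subset fun u hu ↦ ?_
    simpa using hu
  have hcast : ((∑ᶠ u, D u : ℤ) : ℝ) = ∑ᶠ u, (D u : ℝ) :=
    map_finsum (Int.castRingHom ℝ) (D.finiteSupport (isCompact_closedBall _ _))
  rw [hcast, finsum_eq_sum_of_support_subset _ (s := hfin.toFinset) (by simp)]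
  have hDx : ∀ x ∈ Z, (1 : ℝ) ≤ D (x : ℂ) := by
    intro x hx
    obtain ⟨hxI, hx0⟩ := hZ x hx
    have hxU : (x : ℂ) ∈ U := ofReal_mem_closedBall_of_mem_Icc hxI
    have hGx : G x = 0 := (backlundAux_ofReal_eq_zero_iff g y x).2 hx0
    rw [hD, MeromorphicOn.divisor_apply hmer hxU]
    have han : AnalyticAt ℂ G x := hGanU x hxU
    have hne_top : analyticOrderAt G x ≠ ⊤ := by
      intro htop
      rw [analyticOrderAt_eq_top] at htop
      have hpre : IsPreconnected U := (convex_closedBall (c : ℂ) r).isPreconnected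
      have hcU : (c : ℂ) ∈ U := mem_closedBall_self hr.le
      have := hGanU.eqOn_zero_of_preconnected_of_eventuallyEq_zero hpre hxU htop hcU
      exact hGc0 this
    have hpos : 0 < analyticOrderAt G x := by
      rw [pos_iff_ne_zero, Ne, han.analyticOrderAt_eq_zero]
      exact not_not.2 hGx
    obtain ⟨n, hn⟩ := ENat.ne_top_iff_exists.mp hne_top
    rw [← hn] at hpos
    have hn1 : 1 ≤ n := Nat.one_le_iff_ne_zero.2 (by rintro rfl; simp at hpos)
    rw [han.meromorphicOrderAt_eq, ← hn, ENat.map_coe, WithTop.untop₀_coe]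
    exact_mod_cast hn1
  have hsub : Z.image (fun x : ℝ ↦ (x : ℂ)) ⊆ hfin.toFinset := by
    intro u hu
    rw [Finset.mem_image] at hu
    obtain ⟨x, hx, rfl⟩ := hu
    rw [Set.Finite.mem_toFinset, Function.mem_support]
    linarith [hDx x hx]
  have hinj : Set.InjOn (fun x : ℝ ↦ (x : ℂ)) Z := fun x _ x' _ h ↦ Complex.ofReal_injective h
  calc (Z.card : ℝ) = ∑ x ∈ Z, (1 : ℝ) := by simp
    _ ≤ ∑ x ∈ Z, (D (x : ℂ) : ℝ) := Finset.sum_le_sum hDx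
    _ = ∑ u ∈ Z.image (fun x : ℝ ↦ (x : ℂ)), (D u : ℝ) :=
        (Finset.sum_image (f := fun u : ℂ ↦ (D u : ℝ)) hinj).symm
    _ ≤ ∑ u ∈ hfin.toFinset, (D u : ℝ) :=
        Finset.sum_le_sum_of_subset_of_nonneg hsub fun u _ _ ↦ by
          have h0 : (0 : ℤ) ≤ D u := by simpa using hGanU.divisor_nonneg u
          exact_mod_cast h0

/-! ### Backlund's lemma without the `+1`: the `N`-th power trick -/

/-- Logarithmic derivative of a power: `(g^N)'/g^N = N g'/g` at a point where `g` is
differentiable and non-zero. [folklore] -/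
lemma deriv_pow_div_pow {g : ℂ → ℂ} {z : ℂ} (hg : DifferentiableAt ℂ g z) (h0 : g z ≠ 0) (N : ℕ) :
    deriv (fun w ↦ g w ^ N) z / (g z ^ N) = N * (deriv g z / g z) := by
  have hd : HasDerivAt (fun w ↦ g w ^ N) ((N : ℂ) * g z ^ (N - 1) * deriv g z) z :=
    hg.hasDerivAt.pow N
  rw [hd.deriv]
  rcases N with _ | n
  · simp
  · rw [pow_succ]
    field_simp
    push_cast
    ring

/-- **Backlund's lemma, sharp form** (Jensen with the mean, and no `+1`).  Let `g` be analytic at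
every point of the disc `|z - (c+iy)| ≤ R` with `g(c+iy) ≠ 0`, let `0 < r < R`, `[a,b] ⊆ [c-r,c+r]`
with `g ≠ 0` on `[a,b] × {y}`, and let `B ≥ 1` be a majorant of `|g(z+iy)|` and `|g(z̄+iy)|` for
`|z - c| = R` with `log B` circle integrable and `circleAverage (log B) c R ≤ A`.  Then
`|Im ∫_a^b g'/g (x+iy) dx| ≤ π (A - log|g(c+iy)|) / log(R/r)`.
Proof: for `N ≥ 1` apply Backlund's splitting to `h = (e g)^N`, `e = conj g(c+iy)/|g(c+iy)|`
(so `h(c+iy) = |g(c+iy)|^N > 0` and `h'/h = N g'/g`): the zeros of `Re h` on the segment number at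
most `(N A - N log|g(c+iy)|)/log(R/r)` by Jensen's formula for Backlund's auxiliary function of `h`
(bounded by `B^N` on the circle), each of the pieces costs `π`, and one divides by `N → ∞`.
[cite: Titchmarsh1986, §9.4] [cite: HasanalizadeShenWong2022, §3] -/
theorem abs_im_integral_logDeriv_le_of_circleAverage_le {g : ℂ → ℂ} {B : ℂ → ℝ}
    {c y r R A a b : ℝ} (hr : 0 < r) (hrR : r < R)
    (hg : ∀ z ∈ closedBall ((c : ℂ) + y * I) R, AnalyticAt ℂ g z) (hc : g (c + y * I) ≠ 0)
    (hB : ∀ z ∈ sphere (c : ℂ) R, ‖g (z + y * I)‖ ≤ B z ∧ ‖g (conj z + y * I)‖ ≤ B z)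
    (hB1 : ∀ z ∈ sphere (c : ℂ) R, 1 ≤ B z)
    (hBi : CircleIntegrable (fun z ↦ Real.log (B z)) c R)
    (hA : Real.circleAverage (fun z ↦ Real.log (B z)) c R ≤ A)
    (hab : a ≤ b) (ha : c - r ≤ a) (hb : b ≤ c + r) (h0 : ∀ x ∈ Icc a b, g (x + y * I) ≠ 0) :
    |(∫ x : ℝ in a..b, deriv g (x + y * I) / g (x + y * I)).im| ≤
      π * (A - Real.log ‖g (c + y * I)‖) / Real.log (R / r) := by
  have hR : 0 < R := hr.trans hrR
  have hlogRr : 0 < Real.log (R / r) := Real.log_pos (by rw [one_lt_div hr]; exact hrR)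
  set w₀ := g (c + y * I) with hw₀
  have hw₀pos : 0 < ‖w₀‖ := norm_pos_iff.2 hc
  have hw₀n : (‖w₀‖ : ℂ) ≠ 0 := by exact_mod_cast hw₀pos.ne'
  set e : ℂ := conj w₀ / ‖w₀‖ with he
  have he1 : ‖e‖ = 1 := by
    rw [he, norm_div, Complex.norm_conj, Complex.norm_real, Real.norm_eq_abs, abs_norm,
      div_self hw₀pos.ne']
  have he0 : e ≠ 0 := norm_ne_zero_iff.1 (by rw [he1]; exact one_ne_zero)
  have hew : e * w₀ = (‖w₀‖ : ℂ) := by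
    rw [he, div_mul_eq_mul_div, Complex.conj_mul', pow_two, mul_div_assoc, div_self hw₀n, mul_one]
  set g₁ : ℂ → ℂ := fun z ↦ e * g z with hg₁
  -- the segment lies in the disc
  have hseg : ∀ x ∈ Icc a b, (x : ℂ) + y * I ∈ closedBall ((c : ℂ) + y * I) R := by
    intro x hx
    have h1 : (x : ℂ) ∈ closedBall (c : ℂ) R := by
      apply closedBall_subset_closedBall hrR.le
      exact ofReal_mem_closedBall_of_mem_Icc ⟨by linarith [hx.1], by linarith [hx.2]⟩
    exact (mem_closedBall_shift (y := y) h1).1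
  -- circle integrability of `log ‖G‖` for analytic `G`
  have hGint : ∀ {G : ℂ → ℂ}, AnalyticOnNhd ℂ G (closedBall (c : ℂ) R) →
      CircleIntegrable (fun z ↦ Real.log ‖G z‖) c R := by
    intro G hG
    have h1 : AnalyticOnNhd ℂ G (sphere (c : ℂ) |R|) := by
      rw [abs_of_pos hR]; exact hG.mono sphere_subset_closedBall
    exact h1.meromorphicOn.circleIntegrable_log_norm
  -- the bound for each `N ≥ 1`
  have key : ∀ N : ℕ, 0 < N →
      |(∫ x : ℝ in a..b, deriv g (x + y * I) / g (x + y * I)).im| ≤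
        π * (A - Real.log ‖w₀‖) / Real.log (R / r) + π / N := by
    intro N hN
    have hN0 : (0 : ℝ) < N := by exact_mod_cast hN
    set h : ℂ → ℂ := fun z ↦ (g₁ z) ^ N with hh
    have hhan : ∀ z ∈ closedBall ((c : ℂ) + y * I) R, AnalyticAt ℂ h z := fun z hz ↦
      (analyticAt_const.mul (hg z hz)).pow N
    have hhc : h (c + y * I) = ((‖w₀‖ ^ N : ℝ) : ℂ) := by
      simp only [hh, hg₁]
      rw [hew]; push_cast; rfl
    have hhre : (h (c + y * I)).re = ‖w₀‖ ^ N := by rw [hhc, Complex.ofReal_re]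
    have hhre0 : (h (c + y * I)).re ≠ 0 := by rw [hhre]; positivity
    have hhseg : ∀ x ∈ Icc a b, AnalyticAt ℂ h (x + y * I) := fun x hx ↦ hhan _ (hseg x hx)
    have hh0 : ∀ x ∈ Icc a b, h (x + y * I) ≠ 0 := fun x hx ↦
      pow_ne_zero _ (mul_ne_zero he0 (h0 x hx))
    -- the finite set of zeros of `Re h` on `[c-r, c+r]`
    have hfin := finite_zeros_re hr hrR hhan hhre0
    set Z := hfin.toFinset with hZ
    have hzero : ∀ x ∈ Ioo a b, (h (x + y * I)).re = 0 → x ∈ Z := fun x hx h' ↦ by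
      rw [hZ, Set.Finite.mem_toFinset]
      exact ⟨⟨by linarith [hx.1], by linarith [hx.2]⟩, h'⟩
    have hZmem : ∀ x ∈ Z, x ∈ Icc (c - r) (c + r) ∧ (h (x + y * I)).re = 0 := fun x hx ↦ by
      rwa [hZ, Set.Finite.mem_toFinset] at hx
    -- splitting
    have h1 := abs_im_integral_logDeriv_le_of_finset (g := h) y Z.card Z le_rfl hab hhseg hh0 hzero
    -- Jensen, mean form, for `h`: the auxiliary function is bounded by `B^N` on the circle
    have hGan : AnalyticOnNhd ℂ (backlundAux h y) (closedBall (c : ℂ) R) := by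
      intro z hz
      obtain ⟨hz1, hz2⟩ := mem_closedBall_shift (y := y) hz
      exact analyticAt_backlundAux (hhan _ hz1) (hhan _ hz2)
    have hptw : ∀ z ∈ sphere (c : ℂ) |R|,
        Real.log ‖backlundAux h y z‖ ≤ (N : ℝ) * Real.log (B z) := by
      intro z hz
      rw [abs_of_pos hR] at hz
      obtain ⟨hb1, hb2⟩ := hB z hz
      have hBz : 1 ≤ B z := hB1 z hz
      have hn1 : ‖h (z + y * I)‖ ≤ B z ^ N := by
        simp only [hh, hg₁, norm_pow, norm_mul, he1, one_mul]
        exact pow_le_pow_left₀ (norm_nonneg _) hb1 N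
      have hn2 : ‖h (conj z + y * I)‖ ≤ B z ^ N := by
        simp only [hh, hg₁, norm_pow, norm_mul, he1, one_mul]
        exact pow_le_pow_left₀ (norm_nonneg _) hb2 N
      have hGz : ‖backlundAux h y z‖ ≤ B z ^ N := by
        refine (norm_backlundAux_le h y z).trans ?_
        linarith
      rw [← Real.log_pow]
      rcases (norm_nonneg (backlundAux h y z)).eq_or_lt with h0' | hpos
      · rw [← h0', Real.log_zero]
        exact Real.log_nonneg (one_le_pow₀ hBz)
      · exact Real.log_le_log hpos hGz
    have hBiN : CircleIntegrable (fun z ↦ (N : ℝ) * Real.log (B z)) c R :=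
      IntervalIntegrable.const_mul hBi (N : ℝ)
    have hAN : Real.circleAverage (fun z ↦ Real.log ‖backlundAux h y z‖) c R ≤ N * A := by
      calc Real.circleAverage (fun z ↦ Real.log ‖backlundAux h y z‖) c R
          ≤ Real.circleAverage (fun z ↦ (N : ℝ) * Real.log (B z)) c R :=
            Real.circleAverage_mono (hGint hGan) hBiN hptw
        _ = N * Real.circleAverage (fun z ↦ Real.log (B z)) c R := by
            rw [← smul_eq_mul, ← Real.circleAverage_fun_smul]; rfl
        _ ≤ N * A := by gcongr
    have h2 := card_zeros_re_le_of_circleAverage_le hr hrR hhan hhre0 hAN Z hZmem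
    rw [hhre, abs_of_pos (by positivity), Real.log_pow] at h2
    -- `h'/h = N g'/g` on the segment
    have hid : ∀ x ∈ Icc a b, deriv h (x + y * I) / h (x + y * I) =
        (N : ℂ) * (deriv g (x + y * I) / g (x + y * I)) := by
      intro x hx
      have hd : DifferentiableAt ℂ g₁ (x + y * I) :=
        (analyticAt_const.mul (hg _ (hseg x hx))).differentiableAt
      rw [show h = fun w ↦ g₁ w ^ N from rfl, deriv_pow_div_pow hd (mul_ne_zero he0 (h0 x hx)) N]
      congr 1
      exact deriv_const_mul_div_self e he0 _
    have hint : (∫ x : ℝ in a..b, deriv h (x + y * I) / h (x + y * I)) =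
        (N : ℂ) * ∫ x : ℝ in a..b, deriv g (x + y * I) / g (x + y * I) := by
      rw [intervalIntegral.integral_congr (fun x hx ↦ hid x (by rwa [uIcc_of_le hab] at hx)),
        intervalIntegral.integral_const_mul]
    rw [hint, show (N : ℂ) = ((N : ℝ) : ℂ) by norm_cast, Complex.im_ofReal_mul, abs_mul,
      abs_of_pos hN0] at h1
    -- combine
    have h3 : (N : ℝ) * |(∫ x : ℝ in a..b, deriv g (x + y * I) / g (x + y * I)).im| ≤
        π * ((N * A - N * Real.log ‖w₀‖) / Real.log (R / r) + 1) := by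
      calc _ ≤ π * (Z.card + 1) := h1
        _ ≤ π * ((N * A - N * Real.log ‖w₀‖) / Real.log (R / r) + 1) := by gcongr
    have h4 : |(∫ x : ℝ in a..b, deriv g (x + y * I) / g (x + y * I)).im| ≤
        (π * ((N * A - N * Real.log ‖w₀‖) / Real.log (R / r) + 1)) / N := by
      rw [le_div_iff₀ hN0, mul_comm]; exact h3
    refine h4.trans (le_of_eq ?_)
    field_simp
  -- let `N → ∞`
  refine le_of_forall_pos_le_add fun ε hε ↦ ?_
  obtain ⟨N, hN⟩ := exists_nat_gt (π / ε)
  have hNpos : (0 : ℝ) < N := lt_trans (div_pos Real.pi_pos hε) hN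
  have hN' : 0 < N := by exact_mod_cast hNpos
  refine (key N hN').trans ?_
  have : π / N < ε := by
    rw [div_lt_iff₀ hNpos]
    rw [div_lt_iff₀ hε] at hN
    linarith
  linarith

/-- **Backlund's lemma without the `+1`** (the tree's
`Literature.Analysis.Complex.abs_im_integral_logDeriv_le_backlund`, sharpened): for `g` analytic on
`|z - (c+iy)| ≤ R` with `|g| ≤ M` there (`M ≥ 1`), `g(c+iy) ≠ 0`, `0 < r < R` and
`[a,b] ⊆ [c-r, c+r]` with `g ≠ 0` on `[a,b] × {y}`,
`|Im ∫_a^b g'/g (x+iy) dx| ≤ π log(M/|g(c+iy)|)/log(R/r)`. [cite: Titchmarsh1986, §9.4] -/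
theorem abs_im_integral_logDeriv_le_backlund' {g : ℂ → ℂ} {c y r R M a b : ℝ} (hr : 0 < r)
    (hrR : r < R) (hM : 1 ≤ M) (hg : ∀ z ∈ closedBall ((c : ℂ) + y * I) R, AnalyticAt ℂ g z)
    (hgM : ∀ z ∈ closedBall ((c : ℂ) + y * I) R, ‖g z‖ ≤ M) (hc : g (c + y * I) ≠ 0)
    (hab : a ≤ b) (ha : c - r ≤ a) (hb : b ≤ c + r) (h0 : ∀ x ∈ Icc a b, g (x + y * I) ≠ 0) :
    |(∫ x : ℝ in a..b, deriv g (x + y * I) / g (x + y * I)).im| ≤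
      π * Real.log (M / ‖g (c + y * I)‖) / Real.log (R / r) := by
  have hR : 0 < R := hr.trans hrR
  have hB : ∀ z ∈ sphere (c : ℂ) R, ‖g (z + y * I)‖ ≤ M ∧ ‖g (conj z + y * I)‖ ≤ M := by
    intro z hz
    obtain ⟨h1, h2⟩ := mem_closedBall_shift (y := y) (sphere_subset_closedBall hz)
    exact ⟨hgM _ h1, hgM _ h2⟩
  have hBi : CircleIntegrable (fun _ : ℂ ↦ Real.log M) c R := circleIntegrable_const _ _ _
  have hA : Real.circleAverage (fun _ : ℂ ↦ Real.log M) c R ≤ Real.log M := by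
    rw [Real.circleAverage_const]
  have h := abs_im_integral_logDeriv_le_of_circleAverage_le (B := fun _ ↦ M) hr hrR hg hc hB
    (fun _ _ ↦ hM) hBi hA hab ha hb h0
  rwa [← Real.log_div (by linarith) (norm_ne_zero_iff.2 hc)] at h

/-! ### Evaluating circle averages of majorants depending on `Re z` only -/

/-- For real centre `c` and radius `R`, the real part of `circleMap c R θ` is `c + R cos θ`.
[folklore] -/
lemma circleMap_ofReal_re (c R θ : ℝ) : (circleMap (c : ℂ) R θ).re = c + R * Real.cos θ := by
  simp [circleMap, Complex.exp_re, Complex.mul_re]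

/-- **Half-circle reduction.** For a function of the real part only and real `c`, `R`:
`circleAverage (b ∘ re) c R = π⁻¹ ∫₀^π b(c + R cos θ) dθ` (the circle is symmetric under
`θ ↦ 2π - θ`). [folklore] -/
theorem circleAverage_re_eq {b : ℝ → ℝ} {c R : ℝ}
    (hb : ∀ a₁ a₂ : ℝ, IntervalIntegrable (fun θ ↦ b (c + R * Real.cos θ)) volume a₁ a₂) :
    Real.circleAverage (fun z ↦ b z.re) c R = π⁻¹ * ∫ θ in (0 : ℝ)..π, b (c + R * Real.cos θ) := by
  rw [Real.circleAverage_def, smul_eq_mul]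
  simp_rw [circleMap_ofReal_re]
  have hsplit := intervalIntegral.integral_add_adjacent_intervals (hb 0 π) (hb π (2 * π))
  have hsecond : (∫ θ in π..2 * π, b (c + R * Real.cos θ)) = ∫ θ in (0 : ℝ)..π, b (c + R * Real.cos θ) := by
    have h := intervalIntegral.integral_comp_sub_left (fun θ ↦ b (c + R * Real.cos θ)) (2 * π)
      (a := 0) (b := π)
    simp only [Real.cos_two_pi_sub] at h
    rw [show 2 * π - π = π by ring, sub_zero] at h
    exact h.symm
  rw [← hsplit, hsecond, ← two_mul, mul_inv, mul_assoc, ← mul_assoc π⁻¹, mul_comm π⁻¹ 2]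
  have hπ : (π : ℝ) ≠ 0 := Real.pi_ne_zero
  field_simp

/-- **Arc-by-arc integration of affine-in-`cos` majorants.** If `t_0 ≤ t_1 ≤ … ≤ t_m`, `F` is
integrable on each `[t_j, t_{j+1}]` and `F(x) ≤ p_j + q_j cos x` there, then
`∫_{t_0}^{t_m} F ≤ Σ_{j<m} (p_j (t_{j+1} - t_j) + q_j (sin t_{j+1} - sin t_j))`. [folklore] -/
theorem integral_le_sum_affine_cos {F : ℝ → ℝ} (t p q : ℕ → ℝ) :
    ∀ m : ℕ, (∀ j < m, t j ≤ t (j + 1)) →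
      (∀ j < m, IntervalIntegrable F volume (t j) (t (j + 1))) →
      (∀ j < m, ∀ x ∈ Icc (t j) (t (j + 1)), F x ≤ p j + q j * Real.cos x) →
      IntervalIntegrable F volume (t 0) (t m) ∧
        ∫ x in t 0..t m, F x ≤
          ∑ j ∈ Finset.range m, (p j * (t (j + 1) - t j) + q j * (Real.sin (t (j + 1)) - Real.sin (t j))) := by
  intro m
  induction m with
  | zero =>
    intro _ _ _
    simp
  | succ m ih =>
    intro hmono hint hle
    obtain ⟨hI, hS⟩ := ih (fun j hj ↦ hmono j (by omega)) (fun j hj ↦ hint j (by omega))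
      (fun j hj ↦ hle j (by omega))
    have hIm := hint m (by omega)
    refine ⟨hI.trans hIm, ?_⟩
    rw [← intervalIntegral.integral_add_adjacent_intervals hI hIm, Finset.sum_range_succ]
    have hpiece : ∫ x in t m..t (m + 1), F x ≤
        p m * (t (m + 1) - t m) + q m * (Real.sin (t (m + 1)) - Real.sin (t m)) := by
      have hab := hmono m (by omega)
      have hint2 : IntervalIntegrable (fun x ↦ p m + q m * Real.cos x) volume (t m) (t (m + 1)) :=
        (continuous_const.add (continuous_const.mul Real.continuous_cos)).intervalIntegrable _ _
      calc ∫ x in t m..t (m + 1), F x ≤ ∫ x in t m..t (m + 1), (p m + q m * Real.cos x) :=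
            intervalIntegral.integral_mono_on hab hIm hint2 (hle m (by omega))
        _ = p m * (t (m + 1) - t m) + q m * (Real.sin (t (m + 1)) - Real.sin (t m)) := by
            rw [intervalIntegral.integral_add intervalIntegrable_const
                (Real.continuous_cos.intervalIntegrable _ _ |>.const_mul _),
              intervalIntegral.integral_const, intervalIntegral.integral_const_mul, integral_cos]
            simp [smul_eq_mul, mul_comm]
    linarith

end Literature.Analysis.Complex

end
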